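import Mathlib.MeasureTheory.Measure.Regular
import Mathlib.MeasureTheory.Integral.Lebesgue.Add
import Mathlib.Topology.MetricSpace.ProperSpace
import Mathlib.Logic.Equiv.Finset
import Mathlib.Logic.Denumerable
import Mathlib.Data.Rat.Denumerable
import HarnessLib

/-!
# A countable class of test functions determining the order of locally finite measures

Topic `Literature/Probability/Distributions`; measure-theoretic bookkeeping written for the
admissibility clauses of the Garban–Pete–Schramm pivotal kernels of lattice models (route
`Summits/CriticalPhenomena/CardyFormulaZ2/Theses/CardyMeckeFlip`, crux `FlipErgodicityZ2`, stub
"the pivotal kernel of a bond-`ℤ²` sublimit exists and is admissible": joint limits in law only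
deliver almost-sure inequalities `⟨M ε S, φ⟩ ≤ ⟨M ε' S, φ⟩` for COUNTABLY many test functions
`φ`, while clause (ADM)(2) is the inequality of MEASURES `M ε S ≤ M ε' S`), but model-free.

**Results.**
* `measure_le_of_forall_lintegral_le` — if a family `Φ` of measurable functions contains, for
  every open `U`, an increasing sequence `ψ_N` with `ψ_N ≤ 1_U` and `ψ_N(x) = 1` eventually for
  each `x ∈ U`, then for all measures `m, m'` with `m` outer regular,
  `(∀ φ ∈ Φ, ∫⁻ ofReal ∘ φ dm' ≤ ∫⁻ ofReal ∘ φ dm) → m' ≤ m` (monotone convergence for `m'` on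
  open sets, `∫⁻ ψ_N dm ≤ m U`, outer regularity of `m`);
* `exists_countable_approxFamily` — on a proper pseudo-metric space such a family exists which
  is COUNTABLE and consists of continuous, compactly supported, `[0,1]`-valued functions: the
  truncated finite sums `min 1 (Σ_{t ∈ F} b_t)` of the bumps
  `b_{i,r,n}(x) = min 1 (n · max 0 (r - dist x cᵢ))` (centres from a dense sequence, rational
  radii, integer slopes);
* `exists_countable_determining_le` / `exists_countable_determining_eq` — hence a countable
  class in `C_c` determining `≤` (and `=`) among locally finite measures on a proper
  pseudo-metric Borel space (e.g. `ℂ`).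

No named fact, no new definition; Mathlib only.

## References

* O. Kallenberg, *Random Measures, Theory and Applications* (2017), Lemma 1.14 and §4.1
  (countable determining classes in `C_c`).
-/

noncomputable section

open Set Filter Metric
open _root_.MeasureTheory _root_.Topology
open scoped ENNReal

namespace Literature.Probability.Distributions

section Determining

/-! ### The determining property of an approximating family -/

variable {α : Type*} [TopologicalSpace α] [MeasurableSpace α] [OpensMeasurableSpace α]

/-- **Open sets.**  If `Φ` contains an increasing sequence `ψ_N ≤ 1_U`, eventually `1` at each
point of the open set `U`, and `∫⁻ ψ dm' ≤ ∫⁻ ψ dm` on `Φ`, then `m' U ≤ m U` (monotone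
convergence for `m'`; `∫⁻ ψ_N dm ≤ m U`). [folklore] -/
theorem measure_isOpen_le_of_forall_lintegral_le {Φ : Set (α → ℝ)} (hΦm : ∀ φ ∈ Φ, Measurable φ)
    {m m' : Measure α}
    (h : ∀ φ ∈ Φ, ∫⁻ x, ENNReal.ofReal (φ x) ∂m' ≤ ∫⁻ x, ENNReal.ofReal (φ x) ∂m)
    {U : Set α} (hU : IsOpen U) {ψ : ℕ → α → ℝ} (hψΦ : ∀ N, ψ N ∈ Φ) (hmono : Monotone ψ)
    (hle : ∀ N x, ψ N x ≤ U.indicator 1 x) (hone : ∀ x ∈ U, ∃ N, ψ N x = 1) : m' U ≤ m U := by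
  have hmeas : ∀ N, Measurable fun x => ENNReal.ofReal (ψ N x) := fun N =>
    (hΦm _ (hψΦ N)).ennreal_ofReal
  have hmono' : Monotone fun N x => ENNReal.ofReal (ψ N x) := fun N N' hNN' x =>
    ENNReal.ofReal_le_ofReal (hmono hNN' x)
  have hsup : U.indicator (1 : α → ℝ≥0∞) = fun x => ⨆ N, ENNReal.ofReal (ψ N x) := by
    funext x
    by_cases hxU : x ∈ U
    · rw [indicator_of_mem hxU, Pi.one_apply]
      refine le_antisymm ?_ (iSup_le fun N => ?_)
      · obtain ⟨N, hN⟩ := hone x hxU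
        exact le_iSup_of_le N (by rw [hN, ENNReal.ofReal_one])
      · have := hle N x
        rw [indicator_of_mem hxU, Pi.one_apply] at this
        rw [← ENNReal.ofReal_one]
        exact ENNReal.ofReal_le_ofReal this
    · rw [indicator_of_notMem hxU]
      refine le_antisymm bot_le (iSup_le fun N => ?_)
      have := hle N x
      rw [indicator_of_notMem hxU] at this
      rw [ENNReal.ofReal_of_nonpos this]
  have hleU : ∀ N, ∫⁻ x, ENNReal.ofReal (ψ N x) ∂m ≤ m U := fun N => by
    calc ∫⁻ x, ENNReal.ofReal (ψ N x) ∂m ≤ ∫⁻ x, U.indicator 1 x ∂m := by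
          refine lintegral_mono fun x => ?_
          rw [hsup]
          exact le_iSup (fun N => ENNReal.ofReal (ψ N x)) N
      _ = m U := lintegral_indicator_one hU.measurableSet
  calc m' U = ∫⁻ x, U.indicator 1 x ∂m' := (lintegral_indicator_one hU.measurableSet).symm
    _ = ⨆ N, ∫⁻ x, ENNReal.ofReal (ψ N x) ∂m' := by rw [hsup]; exact lintegral_iSup hmeas hmono'
    _ ≤ ⨆ N, ∫⁻ x, ENNReal.ofReal (ψ N x) ∂m := iSup_mono fun N => h _ (hψΦ N)
    _ ≤ m U := iSup_le hleU

/-- **All sets, `m` outer regular.**  If `Φ` contains, for every open `U`, an increasing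
sequence `ψ_N ≤ 1_U` eventually equal to `1` at each point of `U`, then
`(∀ φ ∈ Φ, ∫⁻ φ dm' ≤ ∫⁻ φ dm) → m' ≤ m`. [folklore] -/
theorem measure_le_of_forall_lintegral_le {Φ : Set (α → ℝ)} (hΦm : ∀ φ ∈ Φ, Measurable φ)
    (happrox : ∀ U : Set α, IsOpen U → ∃ ψ : ℕ → α → ℝ, (∀ N, ψ N ∈ Φ) ∧ Monotone ψ ∧
      (∀ N x, ψ N x ≤ U.indicator 1 x) ∧ ∀ x ∈ U, ∃ N, ψ N x = 1)
    {m m' : Measure α} [m.OuterRegular]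
    (h : ∀ φ ∈ Φ, ∫⁻ x, ENNReal.ofReal (φ x) ∂m' ≤ ∫⁻ x, ENNReal.ofReal (φ x) ∂m) : m' ≤ m := by
  refine Measure.le_iff.2 fun A _ => ?_
  rw [A.measure_eq_iInf_isOpen m]
  refine le_iInf₂ fun U hAU => le_iInf fun hU => (measure_mono hAU).trans ?_
  obtain ⟨ψ, hψΦ, hmono, hle, hone⟩ := happrox U hU
  exact measure_isOpen_le_of_forall_lintegral_le hΦm h hU hψΦ hmono hle hone

end Determining

/-! ### A countable approximating family of bumps on a proper pseudo-metric space -/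

section Bumps

/-- **A countable approximating family in `C_c`.**  On a proper pseudo-metric space there is a
countable family `Φ` of continuous, compactly supported, `[0,1]`-valued functions containing,
for every open `U`, an increasing sequence `ψ_N ≤ 1_U` with `ψ_N(x) = 1` eventually for each
`x ∈ U`.  (The truncated finite sums `min 1 (Σ_{t ∈ F} b_t)` of the bumps
`b_{i,r,n}(x) = min 1 (n · max 0 (r - dist x cᵢ))`, `(cᵢ)` a dense sequence, `r ∈ ℚ`, `n ∈ ℕ`;
for `U` open take the bumps whose ball `B(cᵢ, r)` lies in `U`, enumerated.) [folklore] -/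
theorem exists_countable_approxFamily (α : Type*) [PseudoMetricSpace α] [ProperSpace α] :
    ∃ Φ : Set (α → ℝ), Φ.Countable ∧
      (∀ φ ∈ Φ, Continuous φ ∧ HasCompactSupport φ ∧ ∀ x, φ x ∈ Icc (0 : ℝ) 1) ∧
        ∀ U : Set α, IsOpen U → ∃ ψ : ℕ → α → ℝ, (∀ N, ψ N ∈ Φ) ∧ Monotone ψ ∧
          (∀ N x, ψ N x ≤ U.indicator 1 x) ∧ ∀ x ∈ U, ∃ N, ψ N x = 1 := by
  classical
  rcases isEmpty_or_nonempty α with hα | hα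
  · refine ⟨{fun _ => 0}, countable_singleton _, ?_, fun U _ => ⟨fun _ _ => 0, fun _ => rfl,
      fun _ _ _ => le_rfl, fun _ x => (IsEmpty.false x).elim, fun x => (IsEmpty.false x).elim⟩⟩
    rintro φ rfl
    exact ⟨continuous_const, HasCompactSupport.intro isCompact_empty fun _ _ => rfl,
      fun x => ⟨le_rfl, zero_le_one⟩⟩
  -- centres, bumps, truncated bump sums
  set c : ℕ → α := TopologicalSpace.denseSeq α with hc
  have hcd : DenseRange c := TopologicalSpace.denseRange_denseSeq α
  set b : ℕ × ℚ × ℕ → α → ℝ := fun t x =>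
    min 1 ((t.2.2 : ℝ) * max 0 ((t.2.1 : ℝ) - dist x (c t.1))) with hb
  have hbc : ∀ t, Continuous (b t) := fun t =>
    continuous_const.min (continuous_const.mul
      (continuous_const.max (continuous_const.sub (continuous_id.dist continuous_const))))
  have hb0 : ∀ t x, 0 ≤ b t x := fun t x =>
    le_min zero_le_one (mul_nonneg (Nat.cast_nonneg _) (le_max_left _ _))
  have hbzero : ∀ t x, (t.2.1 : ℝ) ≤ dist x (c t.1) → b t x = 0 := fun t x h => by
    show min 1 ((t.2.2 : ℝ) * max 0 ((t.2.1 : ℝ) - dist x (c t.1))) = 0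
    rw [max_eq_left (sub_nonpos.2 h), mul_zero]
    exact min_eq_right zero_le_one
  have hbone : ∀ t x, 1 ≤ (t.2.2 : ℝ) * ((t.2.1 : ℝ) - dist x (c t.1)) → b t x = 1 :=
    fun t x h => min_eq_left
      (h.trans (mul_le_mul_of_nonneg_left (le_max_right _ _) (Nat.cast_nonneg _)))
  set s : Finset (ℕ × ℚ × ℕ) → α → ℝ := fun F x => min 1 (∑ t ∈ F, b t x) with hs
  have hsc : ∀ F, Continuous (s F) := fun F =>
    continuous_const.min (continuous_finsetSum F fun t _ => hbc t)
  have hs01 : ∀ F x, s F x ∈ Icc (0 : ℝ) 1 := fun F x =>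
    ⟨le_min zero_le_one (Finset.sum_nonneg fun t _ => hb0 t x), min_le_left _ _⟩
  have hsmono : ∀ {F G : Finset (ℕ × ℚ × ℕ)}, F ⊆ G → ∀ x, s F x ≤ s G x := fun hFG x =>
    min_le_min_left _ (Finset.sum_le_sum_of_subset_of_nonneg hFG fun t _ _ => hb0 t x)
  have hszero : ∀ (F : Finset (ℕ × ℚ × ℕ)) (x : α), (∀ t ∈ F, (t.2.1 : ℝ) ≤ dist x (c t.1)) →
      s F x = 0 := fun F x h => by
    show min 1 (∑ t ∈ F, b t x) = 0
    rw [Finset.sum_eq_zero fun t ht => hbzero t x (h t ht)]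
    exact min_eq_right zero_le_one
  have hssupp : ∀ F, HasCompactSupport (s F) := fun F => by
    refine HasCompactSupport.intro
      (F.isCompact_biUnion fun t _ => isCompact_closedBall (c t.1) (t.2.1 : ℝ)) fun x hx => ?_
    refine hszero F x fun t ht => ?_
    by_contra hlt
    exact hx (mem_biUnion ht (mem_closedBall.2 (not_le.1 hlt).le))
  -- the family
  refine ⟨range s, countable_range _, ?_, fun U hU => ?_⟩
  · rintro φ ⟨F, rfl⟩
    exact ⟨hsc F, hssupp F, hs01 F⟩
  -- the increasing sequence for an open `U`: good bumps (ball inside `U`), enumerated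
  set G : Set (ℕ × ℚ × ℕ) := {t | ball (c t.1) (t.2.1 : ℝ) ⊆ U} with hG
  set e : (ℕ × ℚ × ℕ) ≃ ℕ := Denumerable.eqv (ℕ × ℚ × ℕ) with he
  set F : ℕ → Finset (ℕ × ℚ × ℕ) := fun N =>
    ((Finset.range N).image e.symm).filter (· ∈ G) with hF
  have hFG : ∀ N, ∀ t ∈ F N, t ∈ G := fun N t ht => (Finset.mem_filter.1 ht).2
  have hFmono : Monotone F := fun N N' hNN' =>
    Finset.filter_subset_filter _ (Finset.image_subset_image (Finset.range_mono hNN'))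
  refine ⟨fun N => s (F N), fun N => mem_range_self _, fun N N' hNN' x => hsmono (hFmono hNN') x,
    fun N x => ?_, fun x hx => ?_⟩
  · by_cases hxU : x ∈ U
    · rw [indicator_of_mem hxU, Pi.one_apply]
      exact (hs01 _ x).2
    · rw [indicator_of_notMem hxU]
      refine (hszero _ x fun t ht => ?_).le
      by_contra hlt
      exact hxU (hFG N t ht (mem_ball.2 (not_le.1 hlt)))
  · -- a good bump equal to `1` at `x`
    obtain ⟨ε, hε, hεU⟩ := Metric.isOpen_iff.1 hU x hx
    obtain ⟨q, hq0, hqε⟩ := exists_rat_btwn (half_pos hε)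
    have hq0' : (0 : ℝ) < q := hq0
    obtain ⟨i, hi⟩ := hcd.exists_dist_lt x (half_pos hq0')
    obtain ⟨n, hn⟩ := exists_nat_ge (2 / (q : ℝ))
    set t₀ : ℕ × ℚ × ℕ := (i, q, n) with ht₀
    have ht₀G : t₀ ∈ G := by
      intro y hy
      refine hεU (mem_ball.2 ?_)
      rw [mem_ball] at hy
      have hi' : dist (c i) x < q / 2 := by rw [dist_comm]; exact hi
      calc dist y x ≤ dist y (c i) + dist (c i) x := dist_triangle _ _ _
        _ < q + q / 2 := add_lt_add hy hi'
        _ < ε := by linarith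
    have hbump : b t₀ x = 1 := by
      refine hbone t₀ x ?_
      have hdist : dist x (c i) < q / 2 := hi
      have h1 : (q : ℝ) / 2 ≤ q - dist x (c i) := by linarith
      have hn' : 1 ≤ (n : ℝ) * ((q : ℝ) / 2) := by
        rw [div_le_iff₀ hq0'] at hn
        linarith
      exact hn'.trans (mul_le_mul_of_nonneg_left h1 n.cast_nonneg)
    refine ⟨e t₀ + 1, le_antisymm (hs01 _ x).2 ?_⟩
    have hmem : t₀ ∈ F (e t₀ + 1) := by
      rw [hF, Finset.mem_filter, Finset.mem_image]
      exact ⟨⟨e t₀, Finset.mem_range.2 (Nat.lt_succ_self _), e.symm_apply_apply t₀⟩, ht₀G⟩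
    show 1 ≤ min 1 (∑ t ∈ F (e t₀ + 1), b t x)
    refine le_min le_rfl ?_
    rw [← hbump]
    exact Finset.single_le_sum (f := fun t => b t x) (fun t _ => hb0 t x) hmem

end Bumps

/-! ### The countable determining class -/

section Class

/-- **A countable determining class for the order of locally finite measures.**  On a proper
pseudo-metric Borel space there is a countable family `Φ` of continuous, compactly supported,
`[0,1]`-valued functions such that for all measures `m, m'` with `m` locally finite,
`(∀ φ ∈ Φ, ∫⁻ ofReal ∘ φ dm' ≤ ∫⁻ ofReal ∘ φ dm) → m' ≤ m`. [folklore] -/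
theorem exists_countable_determining_le (α : Type*) [PseudoMetricSpace α] [ProperSpace α]
    [MeasurableSpace α] [BorelSpace α] :
    ∃ Φ : Set (α → ℝ), Φ.Countable ∧
      (∀ φ ∈ Φ, Continuous φ ∧ HasCompactSupport φ ∧ ∀ x, φ x ∈ Icc (0 : ℝ) 1) ∧
        ∀ m m' : Measure α, IsLocallyFiniteMeasure m →
          (∀ φ ∈ Φ, ∫⁻ x, ENNReal.ofReal (φ x) ∂m' ≤ ∫⁻ x, ENNReal.ofReal (φ x) ∂m) → m' ≤ m := by
  obtain ⟨Φ, hΦc, hΦ, happrox⟩ := exists_countable_approxFamily α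
  refine ⟨Φ, hΦc, hΦ, fun m m' hm h => ?_⟩
  exact measure_le_of_forall_lintegral_le (fun φ hφ => (hΦ φ hφ).1.measurable) happrox h

/-- **Locally finite measures with the same integrals on the determining class are equal.**
[folklore] -/
theorem exists_countable_determining_eq (α : Type*) [PseudoMetricSpace α] [ProperSpace α]
    [MeasurableSpace α] [BorelSpace α] :
    ∃ Φ : Set (α → ℝ), Φ.Countable ∧
      (∀ φ ∈ Φ, Continuous φ ∧ HasCompactSupport φ ∧ ∀ x, φ x ∈ Icc (0 : ℝ) 1) ∧
        ∀ m m' : Measure α, IsLocallyFiniteMeasure m → IsLocallyFiniteMeasure m' →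
          (∀ φ ∈ Φ, ∫⁻ x, ENNReal.ofReal (φ x) ∂m' = ∫⁻ x, ENNReal.ofReal (φ x) ∂m) → m' = m := by
  obtain ⟨Φ, hΦc, hΦ, hdet⟩ := exists_countable_determining_le α
  exact ⟨Φ, hΦc, hΦ, fun m m' hm hm' h =>
    le_antisymm (hdet m m' hm fun φ hφ => (h φ hφ).le) (hdet m' m hm' fun φ hφ => (h φ hφ).ge)⟩

end Class

end Literature.Probability.Distributions

end
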